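import Literature.IUT.HodgeArakelov.ThetaEvaluationModelEvDiagram
import Literature.IUT.HodgeArakelov.AbsTopMonoidsGenuineProducer
import Literature.AnabelianGeometry.AbsoluteAnabelian.MLFGaloisUnitsFunctors
import Literature.AnabelianGeometry.AbsoluteAnabelian.GaloisPadicLogMLF

/-!
# [IUTchII] Cor 1.12 (iii) at the model, GENUINE last arrow: the `α_×`-induced identifications
# `M^{×μ}_TM(Π) ≅ O^{×μ}(G)` built from the [AbsTopIII]-output data (proof companion)

Proof-only sequel (abc-iut cell, D-0067 wave 4, seat abc-iut-w4-d043 gen 3; node **IUTchII:Cor1.12(iii)**) to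
`ThetaEvaluationModelEvDiagram.lean` (abc-iut-w4-d043: the diagram `(†μ,×μ)` for the model theta-evaluation datum with the
last arrow `= {π ∘ (Kummer identification)⁻¹ | π ∈ P₀}` for a NAMED non-empty collection `P₀` of identifications
`𝒪^×_{ℚ̄_p}/μ ≅ O^{×μ}(G)`).  HERE `P₀` IS CONSTRUCTED as print prescribes.  No definition, no `Prop`-valued fact.

S. Mochizuki, *Inter-universal Teichmüller theory II*, kurims manuscript (Dec. 2020): Cor. 1.12 (iii), p. 58: "the final `≅`
denotes the poly-isomorphism induced by the poly-isomorphism `α_×` of Example 1.8, (iii)"; Ex. 1.8 (iii), p. 38: "`α_× :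
(Π ↷ M^×_TM(Π)) ≅ (G ↷ O^×(G))|_Π` determined by the `Γ`-orbit of the poly-isomorphism `α_⊳|_×` induced by the
poly-isomorphism `α_⊳` of (ii)"; Ex. 1.8 (ii), p. 37: "`α_⊳ : (Π ↷ M_TM(Π)) ≅ (G ↷ O^⊳(G))|_Π` determined [in light of
[AbsTopIII], Proposition 3.2, (iv)] by the composite of the natural surjection `Π ↠ Π/Δ` with the full poly-isomorphism of
topological groups `Π/Δ ≅ G`", after "the [uniquely determined] functorial tautological isomorphism `(*TM⊳) (Π ↷ M_TM(Π)) ≅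
(Π/Δ ↷ O^⊳(Π/Δ))|_Π`"; Cor. 1.12 (c), p. 56: "it follows from the definitions [cf. Example 1.8, (ii), (iii); [AbsTopIII],
Definition 3.1, (vi)] that one has a natural inclusion `M^×_TM(Π) ↪ lim_J H¹(J,(l·Δ_Θ)(Π))`" (the unit classes ARE the
Kummer classes of the units `M^×_TM(Π) = M_TM(Π)^×`).  Claim key `Mochizuki2012` (D-0012, DISPUTED); the content proved here
is abelian-group algebra over abc-iut-L6-t1's interface `AbsTopMonoids` and [AbsTopIII] Def. 3.1 (i) bookkeeping
(`(𝒪^⊳_{k̄})^× = 𝒪^×_{k̄}`, abc-iut-L4); it takes no side on [IUTchIII] Cor. 3.12.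

WHAT IS PROVED.
* `AbsTopMonoids.exists_oxmuEquiv_alphaTimes` / `AbsTopMonoids.alphaTimesOxmu_nonempty` — for ANY [AbsTopIII]-output interface
  `A`, isomorph `Π*` (`P`), `G ≅ G_k`, and identification `ιU : V ≅ M_TM(Π*)^×` of a group `V` of unit constants with the units
  of `M_TM(Π*)`: every member `f : Π*/Δ* ⥲ G` of the full poly-isomorphism induces — through `(*TM⊳)` (`A.tauto`) and
  `O^⊳(f)` (`A.mapOtri f`), on units, modulo torsion — an isomorphism `V/μ(V) ≅ O^{×μ}(G)`; the collection of these (the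
  `α_×`-INDUCED poly-isomorphism on `(−)^{×μ}`) is non-empty (`IsoClass` is connected);
* `AbsTopMonoids.genuineOfModel_exists_unitsEquiv` — for abc-iut-L6-t13's GENUINE producer `genuineOfModel S C₀ ε hΔ hq`
  (`M_TM(Π*) = 𝒪^⊳_{k̄}` definitionally), the identification `𝒪^×_{k̄} (≤ k̄ˣ) ≅ M_TM(Π*)^× = (𝒪^⊳_{k̄})^×` is CANONICAL: the
  identity on underlying elements of `k̄` (abc-iut-L4's `unitsEquivUnitSubmonoid`);
* `EtaleLevels.cor112_iii_model_of_unitsEquiv` — the diagram `(†μ,×μ)` for the model datum of record (`Π := Π^tp_{X̲̲}`, REAL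
  `ContH1`, constants `ℚ̄_pˣ` through `ε`, `U := 𝒪^×_{ℚ̄_p}`, canonical retractions; abc-iut-w4-d043 `cor112_iii_model`) for ANY
  `A`, `G` and identification `ιU : 𝒪^×_{ℚ̄_p} ≅ M_TM(Π)^×`, with last arrow EQUAL TO the `α_×`-induced poly-isomorphism
  precomposed with the inverse Kummer identification: `e` is a member iff for some `f : Π/Δ ⥲ G`, `e` carries the class of
  the Kummer class `κ_D u` of every unit `u` to the class of `O^⊳(f)((*TM⊳)(ιU u))`;
* `EtaleLevels.cor112_iii_model_genuine` — the same for the GENUINE producer over the MLF closure datum `(k, ℚ̄_p)` (`k ⊆ ℚ̄_p`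
  the base MLF, `ε : G_k ≅ Gal(ℚ̄_p/k)` the model identification): `e` is a member iff for some `f : Π/Δ ⥲ G`, `e` carries the
  class of `κ_D u` (`u ∈ 𝒪^×_{ℚ̄_p}`) to the class of THE lift to `𝒪^⊳_{ℚ̄_p}` of the Galois automorphism `φ_f` induced by `f`,
  applied to `u` — residual named inputs: `hcU` (Cor. 1.11 (a) cyclotomic rigidity datum bijective), `[G_{ℚ_p} : ε(D_{μ_-})] <
  ∞` + `hDq`/`hlift`/`hemb` ([SemiAnbd] §6), the producer's `ε`/(H1) `hΔ`/(H2) `hq`, and `hOk : 𝒪^×_{ℚ̄_p}` over `k` `=` over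
  `ℚ_p` (base-independence of the unit ball — DISCHARGED in `EtaleLevels.cor112_iii_model_genuine_of_tower` for `k` finite over
  `ℚ_p` inside `ℚ̄_p`, abc-iut-L6-d2's `unitSubmonoid_eq_of_isNonarchimedeanLocalField`).
HONEST FRAMING: nothing here asserts that abc is proved or refuted; typed ≠ discharged; instantiated ≠ endorsed.  The `Ism(G)`-
(`Γ^{×μ}`-)orbit of print is not formed here: for the genuine producer `Ism` is degenerate (abc-iut-L6-t13, MERGE-MAP B9 (d)), and
the typed `MuXmuDiagram.poly₄₅` is a bare set of group isomorphisms.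
-/

noncomputable section

namespace Literature.IUT.HodgeArakelov

open CategoryTheory

universe u

/-! ### The `α_×`-induced identifications on `(−)^{×μ}` — generic [AbsTopIII]-output interface -/

namespace AbsTopMonoids

variable {S : ThetaSetting.{u}} (A : AbsTopMonoids S) (P : IsoClass S.PiX) (G : IsoClass S.Gk)
  {V : Type u} [CommGroup V] (ιU : V ≃* (A.MTM P)ˣ)

/-- **A member of the `α_×`-induced poly-isomorphism on `(−)^{×μ}`** (Ex. 1.8 (ii)–(iv), pp. 37–38; Cor. 1.12 (iii) p. 58
"the poly-isomorphism induced by the poly-isomorphism `α_×`"): for `f : Π*/Δ* ⥲ G` a member of the full poly-isomorphism,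
the composite `V ≅ M_TM(Π*)^× ≅_{(*TM⊳)} O^⊳(Π*/Δ*)^× ≅_{O^⊳(f)} O^×(G)` passes to the quotients by the torsion (torsion is
characteristic, `torsion_characteristic'` = Rmk. 1.12.2 (i)) and yields `V/μ(V) ≅ O^{×μ}(G)` carrying the class of `v` to
the class of `O^⊳(f)((*TM⊳)(ιU v))`. [claim: Mochizuki2012, status: disputed] (IUTchII §1 Ex 1.8 (iii), kurims p.38) -/
theorem exists_oxmuEquiv_alphaTimes
    (f : (⟨TopGroup.quot P.G (A.Delta P), A.quotIso P⟩ : IsoClass S.Gk) ⟶ G) :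
    ∃ π : V ⧸ CommGroup.torsion V ≃* A.Oxmu G, ∀ v : V,
      π (QuotientGroup.mk v) = QuotientGroup.mk (Units.map ((A.tauto P).trans (A.mapOtri f)).toMonoidHom (ιU v)) := by
  let e : V ≃* A.Ounits G := ιU.trans (Units.mapEquiv ((A.tauto P).trans (A.mapOtri f)))
  exact ⟨QuotientGroup.congr (CommGroup.torsion V) (A.Omu G) e (torsion_characteristic' e), fun v => rfl⟩

/-- **The `α_×`-induced poly-isomorphism on `(−)^{×μ}` is non-empty** (the full poly-isomorphism `Π*/Δ* ≅ G` is: `IsoClass`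
is connected). [claim: Mochizuki2012, status: disputed] (IUTchII §1 Ex 1.8 (iii), kurims p.38) -/
theorem alphaTimesOxmu_nonempty :
    {π : V ⧸ CommGroup.torsion V ≃* A.Oxmu G |
      ∃ f : (⟨TopGroup.quot P.G (A.Delta P), A.quotIso P⟩ : IsoClass S.Gk) ⟶ G, ∀ v : V,
        π (QuotientGroup.mk v) =
          QuotientGroup.mk (Units.map ((A.tauto P).trans (A.mapOtri f)).toMonoidHom (ιU v))}.Nonempty := by
  obtain ⟨f⟩ := IsoClass.nonempty_hom (⟨TopGroup.quot P.G (A.Delta P), A.quotIso P⟩ : IsoClass S.Gk) G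
  obtain ⟨π, hπ⟩ := A.exists_oxmuEquiv_alphaTimes P G ιU f
  exact ⟨π, f, hπ⟩

/-! ### The genuine producer: `M_TM(Π*)^× = (𝒪^⊳_{k̄})^× = 𝒪^×_{k̄}` canonically -/

/-- **For abc-iut-L6-t13's GENUINE producer** `genuineOfModel S C₀ ε hΔ hq` (`M_TM(Π*) := 𝒪^⊳_{k̄}` definitionally), the unit
constants `𝒪^×_{k̄} ≤ k̄ˣ` (abc-iut-L4's `unitGroup`, [AbsTopIII] Def. 3.1 (i)) ARE the units `M_TM(Π*)^× = (𝒪^⊳_{k̄})^×`: a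
canonical isomorphism that is the identity on underlying elements of `k̄` (abc-iut-L4's `unitsEquivUnitSubmonoid`). This is the
identification `ιU` at the model (Cor. 1.12 (c): "it follows from the definitions … that one has a natural inclusion
`M^×_TM(Π) ↪ lim_J H¹(J,(l·Δ_Θ)(Π))`" — via the Kummer classes of these units).
[claim: Mochizuki2012, status: disputed] (IUTchII §1 Cor 1.12, kurims p.56) -/
theorem genuineOfModel_exists_unitsEquiv (S : ThetaSetting.{0}) (C₀ : Literature.AnabelianGeometry.AbsoluteAnabelian.MLFClosure.{0})
    (ε : S.Gk ≃ₜ* (Literature.AnabelianGeometry.AbsoluteAnabelian.ModelMLFGaloisData.galois C₀.k C₀.K).tmPair.Pi)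
    (hΔ : ∀ f : S.PiX ≃ₜ* S.PiX, S.DeltaX.map f.toMulEquiv.toMonoidHom = S.DeltaX)
    (hq : Nonempty (TopGroup.quot S.PiX S.DeltaX ≃ₜ* S.Gk)) (P : IsoClass S.PiX) :
    ∃ ι : ↥(Literature.AnabelianGeometry.AbsoluteAnabelian.unitGroup C₀.k C₀.K) ≃* ((genuineOfModel S C₀ ε hΔ hq).MTM P)ˣ,
      ∀ u, (Subtype.val (Units.val (ι u)) : C₀.K) = ((u : (C₀.K)ˣ) : C₀.K) := by
  -- `𝒪^×_{k̄}` as a subgroup of `k̄ˣ` ≅ `𝒪^×_{k̄}` as a submonoid of `k̄` (same underlying elements)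
  let e₁ : ↥(Literature.AnabelianGeometry.AbsoluteAnabelian.unitGroup C₀.k C₀.K) ≃*
      ↥(Literature.AnabelianGeometry.AbsoluteAnabelian.unitSubmonoid C₀.k C₀.K) :=
    { toFun := fun u => ⟨((u : (C₀.K)ˣ) : C₀.K), u.2⟩
      invFun := fun x => ⟨Units.mk0 (x : C₀.K)
          (Literature.AnabelianGeometry.AbsoluteAnabelian.ne_zero_of_mem_unitSubmonoid x.2), x.2⟩
      left_inv := fun u => Subtype.ext (Units.ext rfl)
      right_inv := fun x => Subtype.ext rfl
      map_mul' := fun u v => Subtype.ext rfl }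
  exact ⟨e₁.trans (Literature.AnabelianGeometry.AbsoluteAnabelian.ModelMLFGaloisData.unitsEquivUnitSubmonoid C₀).symm,
    fun u => rfl⟩

end AbsTopMonoids

/-! ### Assembly at the model -/

open Literature.AnabelianGeometry.EtaleTheta Literature.AnabelianGeometry.SemiGraphs CohomologySystemOfContH1
open Literature.AnabelianGeometry.AbsoluteAnabelian
open scoped Literature.AnabelianGeometry.EtaleTheta

namespace EtaleLevels

variable {p : ℕ} [Fact p.Prime] {D : Literature.AnabelianGeometry.EtaleTheta.ThetaSetting p}
  {E : D.EtaleThetaData} {l : ℕ} (C : E.DoubleUnderline l) (hC : D.Compat) (hS : D.Sec2Hyps)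
  (hl : l.Prime) (hp2 : p ≠ 2) (hpl : p ≠ l) (hζ : ∃ ζ : D.K, IsPrimitiveRoot ζ (4 * l))
  (mods : ∀ M : ℕ+, D.CyclotomeMod l M)
  (f : contCocycles D.toTheta D.DeltaTheta C.GtpYdduu) (hf : f ∈ C.rootCocycles hC)
  (hmods : ∀ (M M' : ℕ+) (h : (M : ℕ) ∣ (M' : ℕ)) (x : D.lDeltaTheta l),
    MuN.red p M M' h ((mods M').red x) = (mods M).red x)
  (h15 : Literature.AnabelianGeometry.EtaleTheta.ThetaSetting.Prop15iii E hC) (L : C.CuspLabels)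
  (hZ : ∀ M : ℕ+, Nonempty (ModelCyclotomes.lDeltaQuot (C.rigidData (mods M) hC hS h15 L) ≃*
    Literature.IUT.HodgeTheaters.ZHat))
  (hcharY : EtaleThetaDataOfSetting.PiYddCharacteristic C)
  (hlim : Function.Bijective (rigidLimHom C hC hS hl hp2 hpl hζ mods f hf hmods h15 L hZ))
  (Env : EnvOfGroup (setting C hC hS hl hp2 hpl hζ mods f hf)
    (modelSystem C hC hS hl hp2 hpl hζ mods f hf hmods h15 L hZ).PiX)
  (I : PointedInversion Env (thetaEnvData C hC hS hl hp2 hpl hζ mods f hf hmods h15 L hZ hcharY hlim).D)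
  (hDq : ∀ d ∈ I.Dmu, EtaleThetaDataOfSetting.aug C d = 1 → d = 1)
  (hlift : ∀ K : Subgroup (EtaleThetaDataOfSetting.Pi C), K.FiniteIndex → IsOpen (K : Set (EtaleThetaDataOfSetting.Pi C)) →
    (liftSubgroup (EtaleThetaDataOfSetting.aug C) I.Dmu K).FiniteIndex ∧
      IsOpen (liftSubgroup (EtaleThetaDataOfSetting.aug C) I.Dmu K : Set (EtaleThetaDataOfSetting.Pi C)))
  (hemb : ∀ K : Subgroup (EtaleThetaDataOfSetting.Pi C),
    Topology.IsEmbedding fun d : ↥(I.Dmu ⊓ K) => EtaleThetaDataOfSetting.aug C d.1)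
  (cU : CyclotomeCoefficients (EtaleThetaDataOfSetting.phi C) (D.lDeltaTheta l) (PadicAlgCl p)ˣ)
  (ρlim : (EtaleThetaDataOfSetting.coh C).lim ≃+ (EtaleThetaDataOfSetting.coh C).lim)

/-- **[IUTchII] Cor 1.12 (iii) at the model with the `α_×`-INDUCED last arrow.** For the model datum of record
(`EtaleLevels.thetaEvaluation`: `Π := Π^tp_{X̲̲}`, REAL continuous cohomology of `(l·Δ_Θ)`, constants `ℚ̄_pˣ` through `ε`,
`U := 𝒪^×_{ℚ̄_p}`, canonical retractions, any pointed inversion `I` and any `iotaLim`), ANY [AbsTopIII]-output interface `A` with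
isomorph `Π*` (`P`), `G ≅ G_k`, and identification `ιU : 𝒪^×_{ℚ̄_p} ≅ M_TM(Π*)^×` of the unit constants with the units of
`M_TM(Π*)`: the diagram `(†μ,×μ)` EXISTS (`Q :=` the torsion of `lim_J H¹(Π_Ÿ(M^Θ_*)|_J, Π_μ(M^Θ_*))`, `κ :=` its inclusion)
with last arrow `poly₄₅` EQUAL TO the `α_×`-induced poly-isomorphism precomposed with the inverse Kummer identification: `e`
is a member iff, for some member `f : Π*/Δ* ⥲ G` of the full poly-isomorphism, `e` carries the class of the Kummer class
`κ_D u` of every `u ∈ 𝒪^×_{ℚ̄_p}` to the class of `O^⊳(f)((*TM⊳)(ιU u))`. Residual named inputs: `hcU` (Cor. 1.11 (a) datum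
bijective), `[G_{ℚ_p} : ε(D_{μ_-})] < ∞` + `hDq`/`hlift`/`hemb` ([SemiAnbd] §6), and `ιU`.
[claim: Mochizuki2012, status: disputed] (IUTchII §1 Cor 1.12 (iii), kurims p.58) -/
theorem cor112_iii_model_of_unitsEquiv [(Subgroup.map (EtaleThetaDataOfSetting.aug C) I.Dmu).FiniteIndex]
    (hcU : Function.Bijective cU.hom)
    (A : AbsTopMonoids (setting C hC hS hl hp2 hpl hζ mods f hf)) (P : IsoClass (setting C hC hS hl hp2 hpl hζ mods f hf).PiX)
    (G : IsoClass (setting C hC hS hl hp2 hpl hζ mods f hf).Gk)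
    (ιU : ↥(unitGroup ℚ_[p] (PadicAlgCl p)) ≃* (A.MTM P)ˣ) :
    ∃ Δ : MuXmuDiagram
        (thetaEvaluation C hC hS hl hp2 hpl hζ mods f hf hmods h15 L hZ hcharY hlim Env I
          (LevelRetraction.ofAugmentation (EtaleThetaDataOfSetting.phi C) (D.lDeltaTheta l)
            (EtaleThetaDataOfSetting.aug C) I.Dmu hDq (EtaleThetaDataOfSetting.PiYdd C)
            (EtaleThetaDataOfSetting.continuous_aug C) (aug_ker_acts_trivially C) hlift hemb)
          cU (EtaleThetaDataOfSetting.isOpen_stabilizer_units C) (EtaleThetaDataOfSetting.finiteIndex_stabilizer_units C)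
          (unitGroup ℚ_[p] (PadicAlgCl p)) ρlim) A G
        ↥(AddCommGroup.torsion (thetaEnvData C hC hS hl hp2 hpl hζ mods f hf hmods h15 L hZ hcharY hlim).cohEnv.lim)
        (AddCommGroup.torsion (thetaEnvData C hC hS hl hp2 hpl hζ mods f hf hmods h15 L hZ hcharY hlim).cohEnv.lim).subtype,
      Δ.poly₄₅ = {e | ∃ φ : (⟨TopGroup.quot P.G (A.Delta P), A.quotIso P⟩ :
          IsoClass (setting C hC hS hl hp2 hpl hζ mods f hf).Gk) ⟶ G,
        ∀ (u : ↥(unitGroup ℚ_[p] (PadicAlgCl p)))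
          (m : ↥(thetaEvaluation C hC hS hl hp2 hpl hζ mods f hf hmods h15 L hZ hcharY hlim Env I
            (LevelRetraction.ofAugmentation (EtaleThetaDataOfSetting.phi C) (D.lDeltaTheta l)
              (EtaleThetaDataOfSetting.aug C) I.Dmu hDq (EtaleThetaDataOfSetting.PiYdd C)
              (EtaleThetaDataOfSetting.continuous_aug C) (aug_ker_acts_trivially C) hlift hemb)
            cU (EtaleThetaDataOfSetting.isOpen_stabilizer_units C) (EtaleThetaDataOfSetting.finiteIndex_stabilizer_units C)
            (unitGroup ℚ_[p] (PadicAlgCl p)) ρlim).MxTM),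
          (m : (thetaEvaluation C hC hS hl hp2 hpl hζ mods f hf hmods h15 L hZ hcharY hlim Env I
            (LevelRetraction.ofAugmentation (EtaleThetaDataOfSetting.phi C) (D.lDeltaTheta l)
              (EtaleThetaDataOfSetting.aug C) I.Dmu hDq (EtaleThetaDataOfSetting.PiYdd C)
              (EtaleThetaDataOfSetting.continuous_aug C) (aug_ker_acts_trivially C) hlift hemb)
            cU (EtaleThetaDataOfSetting.isOpen_stabilizer_units C) (EtaleThetaDataOfSetting.finiteIndex_stabilizer_units C)
            (unitGroup ℚ_[p] (PadicAlgCl p)) ρlim).Hd) =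
              Multiplicative.toAdd (h1LimKummer (EtaleThetaDataOfSetting.phi C) (D.lDeltaTheta l) I.Dmu cU
                (EtaleThetaDataOfSetting.isOpen_stabilizer_units C) (EtaleThetaDataOfSetting.finiteIndex_stabilizer_units C) u) →
            e (Multiplicative.ofAdd (QuotientAddGroup.mk m)) =
              QuotientGroup.mk (Units.map ((A.tauto P).trans (A.mapOtri φ)).toMonoidHom (ιU u))} := by
  obtain ⟨Δ, hΔ⟩ := cor112_iii_model C hC hS hl hp2 hpl hζ mods f hf hmods h15 L hZ hcharY hlim Env I hDq hlift hemb cU ρlim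
    hcU A G _ (A.alphaTimesOxmu_nonempty P G ιU)
  refine ⟨Δ, ?_⟩
  rw [hΔ]
  ext e
  simp only [Set.mem_setOf_eq]
  constructor
  · rintro ⟨π, ⟨φ, hπφ⟩, hπ⟩
    exact ⟨φ, fun u m hm => (hπ u m hm).trans (hπφ u)⟩
  · rintro ⟨φ, he⟩
    obtain ⟨π, hπ⟩ := A.exists_oxmuEquiv_alphaTimes P G ιU φ
    exact ⟨π, ⟨φ, hπ⟩, fun u m hm => (he u m hm).trans (hπ u).symm⟩

/-! ### … with the GENUINE [AbsTopIII]-output data of abc-iut-L6-t13 over the MLF closure datum `(k, ℚ̄_p)` -/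

variable
  -- the base MLF `k ⊆ ℚ̄_p` with `k̄ = ℚ̄_p`, and the producer's inputs: the model identification `ε : G_k ≅ Gal(ℚ̄_p/k)`,
  -- (H1) `Δ` characteristic, (H2) `Π/Δ ≅ G_k`
  (k : Type) [Field k] [ValuativeRel k] [TopologicalSpace k] [IsNonarchimedeanLocalField k] [CharZero k]
  [Algebra k (PadicAlgCl p)] [IsAlgClosure k (PadicAlgCl p)]
  (ε : (setting C hC hS hl hp2 hpl hζ mods f hf).Gk ≃ₜ*
    (ModelMLFGaloisData.galois ({ k := k, K := PadicAlgCl p } : MLFClosure.{0}).k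
      ({ k := k, K := PadicAlgCl p } : MLFClosure.{0}).K).tmPair.Pi)
  (hΔ : ∀ φ : (setting C hC hS hl hp2 hpl hζ mods f hf).PiX ≃ₜ* (setting C hC hS hl hp2 hpl hζ mods f hf).PiX,
    (setting C hC hS hl hp2 hpl hζ mods f hf).DeltaX.map φ.toMulEquiv.toMonoidHom =
      (setting C hC hS hl hp2 hpl hζ mods f hf).DeltaX)
  (hq : Nonempty (TopGroup.quot (setting C hC hS hl hp2 hpl hζ mods f hf).PiX (setting C hC hS hl hp2 hpl hζ mods f hf).DeltaX ≃ₜ*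
    (setting C hC hS hl hp2 hpl hζ mods f hf).Gk))

/-- **[IUTchII] Cor 1.12 (iii) at the model with the GENUINE [AbsTopIII]-output data** (abc-iut-L6-t13's
`AbsTopMonoids.genuineOfModel` over the MLF closure datum `(k, ℚ̄_p)`: `O^⊳(G) = M_TM(Π*) = 𝒪^⊳_{ℚ̄_p}`, `(*TM⊳) = id`,
`O^⊳(f) =` THE lift to `𝒪^⊳_{ℚ̄_p}` of the induced Galois automorphism). The diagram `(†μ,×μ)` EXISTS for the model datum of
record and `G ≅ G_k`, with last arrow `poly₄₅` EQUAL TO: `e` is a member iff, for some member `f : Π/Δ ⥲ G` of the full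
poly-isomorphism, `e` carries the class of the Kummer class `κ_D u` of every unit `u ∈ 𝒪^×_{ℚ̄_p}` to the class of
`liftM(φ_f)(u)` — `u` read in `𝒪^⊳_{ℚ̄_p}`, `φ_f` the automorphism of `Gal(ℚ̄_p/k)` induced by `f` through `ε`. Residual named
inputs: `hcU` (Cor. 1.11 (a) datum bijective), `[G_{ℚ_p} : ε(D_{μ_-})] < ∞` + `hDq`/`hlift`/`hemb` ([SemiAnbd] §6), the
producer's `ε`/(H1)/(H2), and `hOk` (the unit ball of `ℚ̄_p` over `k` is that over `ℚ_p`; discharged below for `k/ℚ_p` finite).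
[claim: Mochizuki2012, status: disputed] (IUTchII §1 Cor 1.12 (iii), kurims p.58) -/
theorem cor112_iii_model_genuine [(Subgroup.map (EtaleThetaDataOfSetting.aug C) I.Dmu).FiniteIndex]
    (hcU : Function.Bijective cU.hom)
    (hOk : unitGroup k (PadicAlgCl p) = unitGroup ℚ_[p] (PadicAlgCl p))
    (G : IsoClass (setting C hC hS hl hp2 hpl hζ mods f hf).Gk) :
    ∃ Δ : MuXmuDiagram
        (thetaEvaluation C hC hS hl hp2 hpl hζ mods f hf hmods h15 L hZ hcharY hlim Env I
          (LevelRetraction.ofAugmentation (EtaleThetaDataOfSetting.phi C) (D.lDeltaTheta l)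
            (EtaleThetaDataOfSetting.aug C) I.Dmu hDq (EtaleThetaDataOfSetting.PiYdd C)
            (EtaleThetaDataOfSetting.continuous_aug C) (aug_ker_acts_trivially C) hlift hemb)
          cU (EtaleThetaDataOfSetting.isOpen_stabilizer_units C) (EtaleThetaDataOfSetting.finiteIndex_stabilizer_units C)
          (unitGroup ℚ_[p] (PadicAlgCl p)) ρlim)
        (AbsTopMonoids.genuineOfModel (setting C hC hS hl hp2 hpl hζ mods f hf) { k := k, K := PadicAlgCl p } ε hΔ hq) G
        ↥(AddCommGroup.torsion (thetaEnvData C hC hS hl hp2 hpl hζ mods f hf hmods h15 L hZ hcharY hlim).cohEnv.lim)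
        (AddCommGroup.torsion (thetaEnvData C hC hS hl hp2 hpl hζ mods f hf hmods h15 L hZ hcharY hlim).cohEnv.lim).subtype,
      Δ.poly₄₅ = {e | ∃ φ : AbsTopMonoids.Genuine.qObj hq (IsoClass.base (setting C hC hS hl hp2 hpl hζ mods f hf).PiX) ⟶ G,
        ∀ (u : ↥(unitGroup ℚ_[p] (PadicAlgCl p)))
          (m : ↥(thetaEvaluation C hC hS hl hp2 hpl hζ mods f hf hmods h15 L hZ hcharY hlim Env I
            (LevelRetraction.ofAugmentation (EtaleThetaDataOfSetting.phi C) (D.lDeltaTheta l)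
              (EtaleThetaDataOfSetting.aug C) I.Dmu hDq (EtaleThetaDataOfSetting.PiYdd C)
              (EtaleThetaDataOfSetting.continuous_aug C) (aug_ker_acts_trivially C) hlift hemb)
            cU (EtaleThetaDataOfSetting.isOpen_stabilizer_units C) (EtaleThetaDataOfSetting.finiteIndex_stabilizer_units C)
            (unitGroup ℚ_[p] (PadicAlgCl p)) ρlim).MxTM)
          (w : (nonzeroIntegers k (PadicAlgCl p))ˣ),
          (m : (thetaEvaluation C hC hS hl hp2 hpl hζ mods f hf hmods h15 L hZ hcharY hlim Env I
            (LevelRetraction.ofAugmentation (EtaleThetaDataOfSetting.phi C) (D.lDeltaTheta l)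
              (EtaleThetaDataOfSetting.aug C) I.Dmu hDq (EtaleThetaDataOfSetting.PiYdd C)
              (EtaleThetaDataOfSetting.continuous_aug C) (aug_ker_acts_trivially C) hlift hemb)
            cU (EtaleThetaDataOfSetting.isOpen_stabilizer_units C) (EtaleThetaDataOfSetting.finiteIndex_stabilizer_units C)
            (unitGroup ℚ_[p] (PadicAlgCl p)) ρlim).Hd) =
              Multiplicative.toAdd (h1LimKummer (EtaleThetaDataOfSetting.phi C) (D.lDeltaTheta l) I.Dmu cU
                (EtaleThetaDataOfSetting.isOpen_stabilizer_units C) (EtaleThetaDataOfSetting.finiteIndex_stabilizer_units C) u) →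
          ((w : nonzeroIntegers k (PadicAlgCl p)) : PadicAlgCl p) = ((u : (PadicAlgCl p)ˣ) : PadicAlgCl p) →
            e (Multiplicative.ofAdd (QuotientAddGroup.mk m)) =
              QuotientGroup.mk (Units.map (AbsTopMonoids.Genuine.liftM ({ k := k, K := PadicAlgCl p } : MLFClosure.{0})
                (AbsTopMonoids.Genuine.phiOf ({ k := k, K := PadicAlgCl p } : MLFClosure.{0}) ε φ)).toMonoidHom w)} := by
  -- the canonical identification of the unit constants with `(𝒪^⊳_{ℚ̄_p})^×` (identity on elements of `ℚ̄_p`)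
  obtain ⟨ι, hι⟩ := AbsTopMonoids.genuineOfModel_exists_unitsEquiv (setting C hC hS hl hp2 hpl hζ mods f hf)
    { k := k, K := PadicAlgCl p } ε hΔ hq (IsoClass.base _)
  let ιU : ↥(unitGroup ℚ_[p] (PadicAlgCl p)) ≃*
      ((AbsTopMonoids.genuineOfModel (setting C hC hS hl hp2 hpl hζ mods f hf) { k := k, K := PadicAlgCl p } ε hΔ hq).MTM
        (IsoClass.base _))ˣ :=
    (MulEquiv.subgroupCongr hOk.symm).trans ι
  have hιU : ∀ u : ↥(unitGroup ℚ_[p] (PadicAlgCl p)),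
      (Subtype.val (Units.val (ιU u)) : PadicAlgCl p) = ((u : (PadicAlgCl p)ˣ) : PadicAlgCl p) := fun u => hι _
  -- a unit of `𝒪^⊳_{ℚ̄_p}` is determined by its underlying element of `ℚ̄_p`
  have hw : ∀ (u : ↥(unitGroup ℚ_[p] (PadicAlgCl p))) (w : (nonzeroIntegers k (PadicAlgCl p))ˣ),
      ((w : nonzeroIntegers k (PadicAlgCl p)) : PadicAlgCl p) = ((u : (PadicAlgCl p)ˣ) : PadicAlgCl p) → w = ιU u := by
    intro u w h
    exact Units.ext (Subtype.ext (h.trans (hιU u).symm))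
  obtain ⟨Δ, hΔ'⟩ := cor112_iii_model_of_unitsEquiv C hC hS hl hp2 hpl hζ mods f hf hmods h15 L hZ hcharY hlim Env I hDq hlift
    hemb cU ρlim hcU (AbsTopMonoids.genuineOfModel (setting C hC hS hl hp2 hpl hζ mods f hf) { k := k, K := PadicAlgCl p } ε hΔ hq)
    (IsoClass.base _) G ιU
  refine ⟨Δ, ?_⟩
  rw [hΔ']
  ext e
  simp only [Set.mem_setOf_eq]
  constructor
  · rintro ⟨φ, he⟩
    refine ⟨φ, fun u m w hm hwu => ?_⟩
    rw [he u m hm, hw u w hwu]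
    rfl
  · rintro ⟨φ, he⟩
    refine ⟨φ, fun u m hm => ?_⟩
    rw [he u m (ιU u) hm (hιU u)]
    rfl

/-- … for `k` FINITE OVER `ℚ_p` INSIDE `ℚ̄_p` (the situation at the model: `k = K`, the base field of the curve), the input `hOk`
is a theorem: the unit ball `𝒪^×_{ℚ̄_p}` does not depend on the base (abc-iut-L6-d2's `unitSubmonoid_eq_of_isNonarchimedeanLocalField`,
[AbsTopIII] Def. 3.1 (i)). Residual named inputs: `hcU`, `[G_{ℚ_p} : ε(D_{μ_-})] < ∞` + `hDq`/`hlift`/`hemb`, the producer's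
`ε`/(H1)/(H2). [claim: Mochizuki2012, status: disputed] (IUTchII §1 Cor 1.12 (iii), kurims p.58) -/
theorem cor112_iii_model_genuine_of_tower [Algebra ℚ_[p] k] [FiniteDimensional ℚ_[p] k] [IsScalarTower ℚ_[p] k (PadicAlgCl p)]
    [(Subgroup.map (EtaleThetaDataOfSetting.aug C) I.Dmu).FiniteIndex] (hcU : Function.Bijective cU.hom)
    (G : IsoClass (setting C hC hS hl hp2 hpl hζ mods f hf).Gk) :
    ∃ Δ : MuXmuDiagram
        (thetaEvaluation C hC hS hl hp2 hpl hζ mods f hf hmods h15 L hZ hcharY hlim Env I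
          (LevelRetraction.ofAugmentation (EtaleThetaDataOfSetting.phi C) (D.lDeltaTheta l)
            (EtaleThetaDataOfSetting.aug C) I.Dmu hDq (EtaleThetaDataOfSetting.PiYdd C)
            (EtaleThetaDataOfSetting.continuous_aug C) (aug_ker_acts_trivially C) hlift hemb)
          cU (EtaleThetaDataOfSetting.isOpen_stabilizer_units C) (EtaleThetaDataOfSetting.finiteIndex_stabilizer_units C)
          (unitGroup ℚ_[p] (PadicAlgCl p)) ρlim)
        (AbsTopMonoids.genuineOfModel (setting C hC hS hl hp2 hpl hζ mods f hf) { k := k, K := PadicAlgCl p } ε hΔ hq) G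
        ↥(AddCommGroup.torsion (thetaEnvData C hC hS hl hp2 hpl hζ mods f hf hmods h15 L hZ hcharY hlim).cohEnv.lim)
        (AddCommGroup.torsion (thetaEnvData C hC hS hl hp2 hpl hζ mods f hf hmods h15 L hZ hcharY hlim).cohEnv.lim).subtype,
      Δ.poly₄₅ = {e | ∃ φ : AbsTopMonoids.Genuine.qObj hq (IsoClass.base (setting C hC hS hl hp2 hpl hζ mods f hf).PiX) ⟶ G,
        ∀ (u : ↥(unitGroup ℚ_[p] (PadicAlgCl p)))
          (m : ↥(thetaEvaluation C hC hS hl hp2 hpl hζ mods f hf hmods h15 L hZ hcharY hlim Env I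
            (LevelRetraction.ofAugmentation (EtaleThetaDataOfSetting.phi C) (D.lDeltaTheta l)
              (EtaleThetaDataOfSetting.aug C) I.Dmu hDq (EtaleThetaDataOfSetting.PiYdd C)
              (EtaleThetaDataOfSetting.continuous_aug C) (aug_ker_acts_trivially C) hlift hemb)
            cU (EtaleThetaDataOfSetting.isOpen_stabilizer_units C) (EtaleThetaDataOfSetting.finiteIndex_stabilizer_units C)
            (unitGroup ℚ_[p] (PadicAlgCl p)) ρlim).MxTM)
          (w : (nonzeroIntegers k (PadicAlgCl p))ˣ),
          (m : (thetaEvaluation C hC hS hl hp2 hpl hζ mods f hf hmods h15 L hZ hcharY hlim Env I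
            (LevelRetraction.ofAugmentation (EtaleThetaDataOfSetting.phi C) (D.lDeltaTheta l)
              (EtaleThetaDataOfSetting.aug C) I.Dmu hDq (EtaleThetaDataOfSetting.PiYdd C)
              (EtaleThetaDataOfSetting.continuous_aug C) (aug_ker_acts_trivially C) hlift hemb)
            cU (EtaleThetaDataOfSetting.isOpen_stabilizer_units C) (EtaleThetaDataOfSetting.finiteIndex_stabilizer_units C)
            (unitGroup ℚ_[p] (PadicAlgCl p)) ρlim).Hd) =
              Multiplicative.toAdd (h1LimKummer (EtaleThetaDataOfSetting.phi C) (D.lDeltaTheta l) I.Dmu cU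
                (EtaleThetaDataOfSetting.isOpen_stabilizer_units C) (EtaleThetaDataOfSetting.finiteIndex_stabilizer_units C) u) →
          ((w : nonzeroIntegers k (PadicAlgCl p)) : PadicAlgCl p) = ((u : (PadicAlgCl p)ˣ) : PadicAlgCl p) →
            e (Multiplicative.ofAdd (QuotientAddGroup.mk m)) =
              QuotientGroup.mk (Units.map (AbsTopMonoids.Genuine.liftM ({ k := k, K := PadicAlgCl p } : MLFClosure.{0})
                (AbsTopMonoids.Genuine.phiOf ({ k := k, K := PadicAlgCl p } : MLFClosure.{0}) ε φ)).toMonoidHom w)} := by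
  refine cor112_iii_model_genuine C hC hS hl hp2 hpl hζ mods f hf hmods h15 L hZ hcharY hlim Env I hDq hlift hemb cU ρlim k ε hΔ
    hq hcU ?_ G
  -- `𝒪^×_{ℚ̄_p}` over `k` = over `ℚ_p` (same underlying submonoid of `ℚ̄_p`)
  ext u
  rw [mem_unitGroup_iff, mem_unitGroup_iff, unitSubmonoid_eq_of_isNonarchimedeanLocalField p]

end EtaleLevels

end Literature.IUT.HodgeArakelov

end
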